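import Summits.Ventures.PercRepro.C025ProfileHallSimpleReduction
import Summits.Ventures.PercRepro.C025ProfileHallOne

/-!
# C-032 / C-033 — ONE ROW reduces to simple matroids given the previous diagonal row (night-3 g7)

`profileIneq_row_of_simple`: if `(Π_{q+1,u+1})` holds for every SIMPLE finite matroid and `(Π_{q,u})` holds for every
finite matroid, then `(Π_{q+1,u+1})` holds for every finite matroid — the single-row form of `profileIneq_of_simple_all`
(loop step; parallel-pair step `profileIneq_of_delete_parallel_gen` with the lower row on `M ／ e`; simple case by
hypothesis). `hallIneq_row_of_simple` is the same for `(H⁺)`. Consequences for the first open row: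
`profileIneq_two_three_of_simple` / `hallIneq_two_three_of_simple` — `(Π_{2,3})` resp. `(H⁺_{2,3})` for every finite
matroid follows from the simple case alone, the row `(1,2)` being a tree theorem (`profileIneq_one_all`, `hallIneq_one_all`).
-/

open scoped Matroid

namespace PercRepro

open Set Finset ThmH

section RowReduction

variable {α : Type} [DecidableEq α]

/-- **One row of `(Π)` reduces to simple matroids given the previous diagonal row.** -/
theorem profileIneq_row_of_simple {q u : ℕ} (hqu : q ≤ u)
    (hS : ∀ (N : Matroid α) [N.Finite], (∀ T ⊆ N.E, T.encard ≤ 2 → N.Indep T) → Profile.ProfileIneq N (q + 1) (u + 1))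
    (hlow : ∀ (N : Matroid α) [N.Finite], Profile.ProfileIneq N q u)
    (M : Matroid α) [M.Finite] : Profile.ProfileIneq M (q + 1) (u + 1) := by
  suffices h : ∀ n : ℕ, ∀ (N : Matroid α) [N.Finite], (gr N).card = n → Profile.ProfileIneq N (q + 1) (u + 1) from
    h _ M rfl
  intro n
  induction n using Nat.strong_induction_on with
  | _ n ih =>
  intro N _ hN
  by_cases hloop : ∃ ℓ, N.IsLoop ℓ
  · obtain ⟨ℓ, hℓ⟩ := hloop
    have hℓE : ℓ ∈ gr N := by rw [← Finset.mem_coe, coe_gr]; exact hℓ.mem_ground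
    apply profileIneq_of_delete_isLoop hℓ
    apply ih ((gr N).erase ℓ).card _ (N ＼ ({ℓ} : Set α)) (by rw [gr_delete_singleton''])
    rw [← hN]; exact Finset.card_erase_lt_of_mem hℓE
  · have hl : ∀ x ∈ N.E, N.IsNonloop x := fun x hx => N.isNonloop_of_not_isLoop hx (fun h => hloop ⟨x, h⟩)
    by_cases hpar : ∃ e f, f ∈ N.E ∧ f ≠ e ∧ e ∈ N.closure {f}
    · obtain ⟨e, f, hfE, hfe, hef⟩ := hpar
      have heE : e ∈ gr N := by rw [← Finset.mem_coe, coe_gr]; exact N.closure_subset_ground _ hef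
      have hlt : ((gr N).erase e).card < n := by rw [← hN]; exact Finset.card_erase_lt_of_mem heE
      apply profileIneq_of_delete_parallel_gen hl hfE hfe hef hqu
      · exact ih _ hlt (N ＼ ({e} : Set α)) (by rw [gr_delete_singleton''])
      · exact hlow (N ／ ({e} : Set α))
    · push Not at hpar
      exact hS N (simple_of_no_loop_no_parallel hl hpar)

/-- **One row of `(H⁺)` reduces to simple matroids given the previous diagonal row.** -/
theorem hallIneq_row_of_simple {q u : ℕ} (hqu : q ≤ u)
    (hS : ∀ (N : Matroid α) [N.Finite], (∀ T ⊆ N.E, T.encard ≤ 2 → N.Indep T) → Profile.HallIneq N (q + 1) (u + 1))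
    (hlow : ∀ (N : Matroid α) [N.Finite], Profile.HallIneq N q u)
    (M : Matroid α) [M.Finite] : Profile.HallIneq M (q + 1) (u + 1) := by
  suffices h : ∀ n : ℕ, ∀ (N : Matroid α) [N.Finite], (gr N).card = n → Profile.HallIneq N (q + 1) (u + 1) from
    h _ M rfl
  intro n
  induction n using Nat.strong_induction_on with
  | _ n ih =>
  intro N _ hN
  by_cases hloop : ∃ ℓ, N.IsLoop ℓ
  · obtain ⟨ℓ, hℓ⟩ := hloop
    have hℓE : ℓ ∈ gr N := by rw [← Finset.mem_coe, coe_gr]; exact hℓ.mem_ground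
    apply hallIneq_of_delete_isLoop hℓ
    apply ih ((gr N).erase ℓ).card _ (N ＼ ({ℓ} : Set α)) (by rw [gr_delete_singleton''])
    rw [← hN]; exact Finset.card_erase_lt_of_mem hℓE
  · have hl : ∀ x ∈ N.E, N.IsNonloop x := fun x hx => N.isNonloop_of_not_isLoop hx (fun h => hloop ⟨x, h⟩)
    by_cases hpar : ∃ e f, f ∈ N.E ∧ f ≠ e ∧ e ∈ N.closure {f}
    · obtain ⟨e, f, hfE, hfe, hef⟩ := hpar
      have heE : e ∈ gr N := by rw [← Finset.mem_coe, coe_gr]; exact N.closure_subset_ground _ hef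
      have hlt : ((gr N).erase e).card < n := by rw [← hN]; exact Finset.card_erase_lt_of_mem heE
      apply hallIneq_of_delete_parallel_gen hl hfE hfe hef hqu
      · exact ih _ hlt (N ＼ ({e} : Set α)) (by rw [gr_delete_singleton''])
      · exact hlow (N ／ ({e} : Set α))
    · push Not at hpar
      exact hS N (simple_of_no_loop_no_parallel hl hpar)

/-- **The first open row `(Π_{2,3})` for every finite matroid follows from its simple case** (the row `(1,2)` is
`profileIneq_one_all`). -/
theorem profileIneq_two_three_of_simple
    (hS : ∀ (N : Matroid α) [N.Finite], (∀ T ⊆ N.E, T.encard ≤ 2 → N.Indep T) → Profile.ProfileIneq N 2 3)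
    (M : Matroid α) [M.Finite] : Profile.ProfileIneq M 2 3 :=
  profileIneq_row_of_simple (q := 1) (u := 2) (by omega) hS (fun N _ => profileIneq_one_all N 2 (by omega)) M

/-- **`(H⁺_{2,3})` for every finite matroid and every family follows from its simple case** (the row `(1,2)` is
`hallIneq_one_all`). -/
theorem hallIneq_two_three_of_simple
    (hS : ∀ (N : Matroid α) [N.Finite], (∀ T ⊆ N.E, T.encard ≤ 2 → N.Indep T) → Profile.HallIneq N 2 3)
    (M : Matroid α) [M.Finite] : Profile.HallIneq M 2 3 :=
  hallIneq_row_of_simple (q := 1) (u := 2) (by omega) hS (fun N _ => hallIneq_one_all N 2 (by omega)) M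

end RowReduction

end PercRepro
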